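import Summits.HodgeConjecture.HodgeConjecture.Theorems.NodalThetaWeilNodeDualClassesAlgebraicThreefoldCarrier
import Literature.AlgebraicGeometry.HodgeTheory.SmoothCyclesInNodalHypersurfaces
import Literature.AlgebraicGeometry.Motives.AbelianVarietyProjectiveChart
import HarnessLib

/-!
# Crux `NodeDualClassesAlgebraic` (stmt-HodgeConjecture-7745), nodal-boundary line — part 4:
# THE NODAL-THETA LOCATION IS FREE (Kleiman's smoothing + Thomas's nodal Bertini)

Route `HodgeConjecture/NodalThetaWeil`; continuation of parts 1–3. Part 3 proved, unconditionally,
`WeilSixfolds ↔ ThreefoldWeilCarriers` («every balanced Weil sixfold carries a smooth projective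
threefold `g : V ⟶ A` whose class `g_* 1_V` is not in the mixed `K`-eigenclass span `W'`»). The
route's thesis LOCATES the cycle on a NODAL member of `|kΘ|`, `k ≥ 2` (Thomas 2005: a Weil class can
enter theta geometry only through the nodes of singular members). This file records the two classical
theorems of Thomas's §4 ("Only if") that make the location automatic once the cycle exists — the NAMED
FACTS of `Literature/AlgebraicGeometry/HodgeTheory/SmoothCyclesInNodalHypersurfaces` (statement-only,
cite-tagged, sixfold/threefold case) — and proves the equivalence modulo them:

* `Kleiman1969_algebraicClasses_le_span_smoothThreefolds` — Kleiman's smoothing theorem in the form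
  Thomas uses it (Thm. 5: an effective `3`-cycle `Z` on a smooth projective sixfold satisfies
  `2[Z] + N H³ ∼_alg` a SMOOTH cycle for `N ≫ 0`; with `H³` itself the class of a smooth linear section)
  ⟹ on the carriers: `N³H⁶(X(ℂ); ℂ)` is spanned by the classes `j_* 1_Z` of smooth CLOSED threefolds
  `j : Z ↪ X`.
* `Thomas2005_smoothThreefold_in_nodalMember` — Thm. 6 (after Altman–Kleiman): a smooth closed
  threefold `Z` of a smooth projective sixfold lies, for every ample `Θ` and all `k ≫ 0`, on a member
  `D ∈ |kΘ|` whose only singularities are ordinary double points located on `Z` (apply Thm. 6 to the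
  embedding by `|k₁Θ|`).

§2 `nodalThetaCarriers₀_of_threefoldWeilCarriers` (modulo the two facts), its trivial converse, and
**`weilSixfolds_iff_nodalThetaCarriers₀`**: the target `WeilSixfolds` (stmt-2524) — hence, with part
3, both cruxes X1 (7744) and X2 (7745) — is EQUIVALENT, given Kleiman + Thomas, to the nodal-boundary
carrier statement «every balanced Weil sixfold has an ample `Θ`, `k ≥ 2`, a nodal member `ι : D ↪ A` of
`|kΘ|` and a smooth projective threefold `h : V ⟶ D` with `(h ≫ ι)_* 1_V ∉ W'`» (`NodalThetaCarriers₀`: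
the statement of parts 1–3 without the clauses "`≥ 1` node" and "through a node", which the facts as
printed do not supply — the node count `c₃(ν_Z^*(k))` is positive for `k ≫ 0` but that is not typed).
So AT `n = 3` THE NODAL DECORATION CARRIES NO CONTENT BEYOND THE CYCLE: the difficulty of the route is
exactly "one threefold with a non-vanishing `K`-certificate per balanced Weil sixfold".

HONEST STATUS. Two named facts (Thomas 2005 Thm. 5 = Kleiman 1969, Thm. 6 = Altman–Kleiman 1979),
consumed BY NAME as hypotheses (conditional results; nothing discharges them here); nothing here is a
case of the Hodge conjecture. References: [Thomas2005Nodes] §4 Thms. 5–6; [Kleiman1969Grassmannians];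
Altman–Kleiman, Comm. Algebra 7 (1979) 775–790.
-/

noncomputable section

set_option linter.dupNamespace false

open CategoryTheory AlgebraicGeometry
open Literature.AlgebraicGeometry.Motives Literature.AlgebraicGeometry.HodgeTheory
  Literature.AlgebraicGeometry.Resolution
  Literature.AlgebraicTopology.SingularHomology
open Summit.HodgeConjecture.HodgeConjecture.Theses.NodalThetaWeil

namespace Summit.HodgeConjecture.HodgeConjecture.Theorems.NodeDualClassesAlgebraic

/-! ## §1 The two classical facts of Thomas's §4

They are the named facts `Kleiman1969_algebraicClasses_le_span_smoothThreefolds` (Thm. 5 = Kleiman's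
smoothing theorem, sixfold/threefold case, in cohomology) and `Thomas2005_smoothThreefold_in_nodalMember`
(Thm. 6, after Altman–Kleiman) of `Literature/AlgebraicGeometry/HodgeTheory/SmoothCyclesInNodalHypersurfaces`,
consumed below BY NAME as hypotheses (D-0014: conditional results; nothing here discharges them). -/

/-! ## §2 The nodal-theta location is free -/

/-- `nonWeil A φ d` — the span `W'` of the mixed `K`-eigenclass spaces of `H⁶(A(ℂ); ℂ)` (display only;
same text as in parts 2–3). -/
local notation3 "nonWeil " A:max φ:max d:max =>
  (⨆ (a : ℕ) (b : ℕ) (_ : a + b = 2 * 3) (_ : 0 < a) (_ : 0 < b),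
    pullbackEigenclasses A φ (2 * 3) (fun x y =>
      ((x : ℂ) + (y : ℂ) * Complex.I * (Real.sqrt d : ℂ)) ^ a *
        ((x : ℂ) - (y : ℂ) * Complex.I * (Real.sqrt d : ℂ)) ^ b))

/-- `ThreefoldWeilCarriers` (display only; same text as in part 3). -/
local notation3 (prettyPrint := false) "ThreefoldWeilCarriers" =>
  (∀ (d : ℕ), 0 < d → ∀ (A : AbelianVariety ℂ) (φ : A ⟶ A), A.dim = 2 * 3 →
    ∀ hsp : IsSmoothProjective (2 * 3) A.X, φ ≫ φ = -(d • 𝟙 A) →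
    Module.finrank ℂ ↥(Module.End.eigenspace (complexBetti.map φ.hom.hom.hom 1).hom
          (Complex.I * (Real.sqrt d : ℂ)) ⊓ hodgeOneZero hsp) = 3 →
    ∃ (V : SchemeOver ℂ) (hV : IsSmoothProjective 3 V) (g : V ⟶ A.X),
      complexGysin complexOrientationFamily hV hsp g
        (rfl : 0 + 2 * (2 * 3) = 2 * 3 + 2 * 3)
        (singularCohomology.one ℂ (ComplexPoints V)) ∉ nonWeil A φ d)

/-- `NodalThetaCarriers₀` (display only) — the nodal-boundary carrier statement WITHOUT the clauses
"`≥ 1` node" and "through a node": every balanced Weil sixfold has an ample `Θ`, `k ≥ 2`, a nodal member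
`ι : D ↪ A` of `|kΘ|` (some number `m ≥ 0` of nodes), and a smooth projective threefold `h : V ⟶ D`
whose class `(h ≫ ι)_* 1_V` is not in the mixed span. -/
local notation3 (prettyPrint := false) "NodalThetaCarriers₀" =>
  (∀ (d : ℕ), 0 < d → ∀ (A : AbelianVariety ℂ) (φ : A ⟶ A), A.dim = 2 * 3 →
    ∀ hsp : IsSmoothProjective (2 * 3) A.X, φ ≫ φ = -(d • 𝟙 A) →
    Module.finrank ℂ ↥(Module.End.eigenspace (complexBetti.map φ.hom.hom.hom 1).hom
          (Complex.I * (Real.sqrt d : ℂ)) ⊓ hodgeOneZero hsp) = 3 →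
    ∃ (Θ : CartierDivisor A.X.left) (k : ℕ) (D : SchemeOver ℂ) (ι : D ⟶ A.X),
      Θ.IsAmple ∧ 2 ≤ k ∧ (∃ m : ℕ, IsNodalDivisor 5 m ι) ∧
      (∃ hI : IsEffectiveCartier (ι).left.ker,
        (CartierDivisor.ofIsEffectiveCartier (ι).left.ker hI).LinEquiv (k • Θ)) ∧
      ∃ (V : SchemeOver ℂ) (hV : IsSmoothProjective 3 V) (h : V ⟶ D),
        complexGysin complexOrientationFamily hV hsp (h ≫ ι)
          (rfl : 0 + 2 * (2 * 3) = 2 * 3 + 2 * 3)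
          (singularCohomology.one ℂ (ComplexPoints V)) ∉ nonWeil A φ d)

section Free

variable {A : AbelianVariety ℂ}

/-- **The converse inclusion of Kleiman's fact is a theorem**: the class `j_* 1_Z` of a smooth closed
threefold of a smooth projective sixfold is algebraic (`complexGysin_one_mem_algebraicClasses_codim`), so
`Kleiman1969_algebraicClasses_le_span_smoothThreefolds` says that `N³H⁶` is EXACTLY the span of the
smooth closed threefold classes. [cite: Thomas2005Nodes, Thm. 5] [cite: Fulton1998, §19.1] -/
theorem span_smoothThreefolds_le_algebraicClasses {X : SchemeOver ℂ} (hX : IsSmoothProjective (2 * 3) X) :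
    Submodule.span ℂ
      {c : complexBetti X (2 * 3) | ∃ (Z : SchemeOver ℂ) (hZ : IsSmoothProjective 3 Z)
        (j : Z ⟶ X), IsClosedImmersion j.left ∧
          c = complexGysin complexOrientationFamily hZ hX j (rfl : 0 + 2 * (2 * 3) = 2 * 3 + 2 * 3)
            (singularCohomology.one ℂ (ComplexPoints Z))} ≤ algebraicClasses X 3 := by
  refine Submodule.span_le.mpr ?_
  rintro _ ⟨Z, hZ, j, -, rfl⟩
  exact complexGysin_one_mem_algebraicClasses_codim complexOrientationFamily
    (show 3 + 3 = 2 * 3 by norm_num) hZ hX j _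

/-- **Kleiman: an algebraic class off the mixed span can be carried by a smooth CLOSED threefold.**
If some algebraic class of `H⁶(A(ℂ); ℂ)` is not in `W'`, then some smooth closed threefold
`j : Z ↪ A` has `j_* 1_Z ∉ W'` (the smooth closed threefold classes span `N³H⁶` by
`Kleiman1969_algebraicClasses_le_span_smoothThreefolds`, and a span lies in the submodule `W'` as soon
as its generators do). [cite: Thomas2005Nodes, Thm. 5] -/
theorem exists_smoothClosedThreefold_not_mem_nonWeil
    (hK : Kleiman1969_algebraicClasses_le_span_smoothThreefolds) {d : ℕ}
    (hX : IsSmoothProjective (2 * 3) A.X) {φ : A ⟶ A}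
    (hex : ∃ s ∈ algebraicClasses A.X 3, s ∉ nonWeil A φ d) :
    ∃ (Z : SchemeOver ℂ) (hZ : IsSmoothProjective 3 Z) (j : Z ⟶ A.X), IsClosedImmersion j.left ∧
      complexGysin complexOrientationFamily hZ hX j (rfl : 0 + 2 * (2 * 3) = 2 * 3 + 2 * 3)
        (singularCohomology.one ℂ (ComplexPoints Z)) ∉ nonWeil A φ d := by
  obtain ⟨s, hs, hsW'⟩ := hex
  by_contra! hall
  apply hsW'
  refine (Submodule.span_le.mpr ?_) (hK A.X hX hs)
  rintro _ ⟨Z, hZ, j, hj, rfl⟩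
  exact hall Z hZ j hj

/-- **Given Kleiman + Thomas, the threefold carrier statement implies the nodal-boundary carrier
statement**: smooth the carrying threefold inside its class modulo `W'` (Kleiman), choose an ample
`Θ` on `A` (`ChartFamily.exists_isAmple_of_chart`), and put the smooth closed threefold on a nodal
member of `|kΘ|`, `k ≥ 2` (Thomas, Thm. 6); the class is unchanged (`h ≫ ι = j`).
[cite: Thomas2005Nodes, §4 Thms. 5–6] -/
theorem nodalThetaCarriers₀_of_threefoldWeilCarriers
    (hK : Kleiman1969_algebraicClasses_le_span_smoothThreefolds)
    (hT : Thomas2005_smoothThreefold_in_nodalMember) (hC : ThreefoldWeilCarriers) :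
    NodalThetaCarriers₀ := by
  intro d hd A φ hdim hsp hφ hbal
  -- a smooth CLOSED threefold off the mixed span
  have hex : ∃ s ∈ algebraicClasses A.X 3, s ∉ nonWeil A φ d :=
    (exists_algebraic_not_mem_nonWeil_iff_exists_threefold hsp).mpr (hC d hd A φ hdim hsp hφ hbal)
  obtain ⟨Z, hZ, j, hj, hjW'⟩ := exists_smoothClosedThreefold_not_mem_nonWeil hK hsp hex
  -- an ample `Θ`, and a nodal member of `|kΘ|`, `k ≥ 2`, through `Z`
  obtain ⟨Θ, hΘ⟩ := ChartFamily.exists_isAmple_of_chart A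
  obtain ⟨k, m, D, ι, h, hk, hnod, hlin, hfac, -⟩ := hT A.X hsp Θ hΘ Z hZ j hj 2
  refine ⟨Θ, k, D, ι, hΘ, hk, ⟨m, hnod⟩, hlin, Z, hZ, h, ?_⟩
  -- the class of `Z` through `D` is the class of `Z`
  have e : (h ≫ ι) = j := hfac
  rw [e]
  exact hjW'

/-- **The nodal-boundary carrier statement implies the threefold carrier statement** by forgetting the
theta clauses. [cite: Thomas2005Nodes, Thm. 1] -/
theorem threefoldWeilCarriers_of_nodalThetaCarriers₀ (hN : NodalThetaCarriers₀) :
    ThreefoldWeilCarriers := by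
  intro d hd A φ hdim hsp hφ hbal
  obtain ⟨Θ, k, D, ι, -, -, -, -, V, hV, h, hvis⟩ := hN d hd A φ hdim hsp hφ hbal
  exact ⟨V, hV, h ≫ ι, hvis⟩

/-- **THE NODAL-THETA LOCATION IS FREE.** Given Kleiman's smoothing theorem and Thomas's nodal
Bertini theorem (the named facts of §1), the route target `WeilSixfolds` (stmt-HodgeConjecture-2524)
— equivalently (part 3) `ThreefoldWeilCarriers`, equivalently the conjunction of the two cruxes of
route `NodalThetaWeil` — is EQUIVALENT to the nodal-boundary carrier statement `NodalThetaCarriers₀`: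
per balanced Weil sixfold, one smooth projective threefold on a nodal member of some `|kΘ|`, `k ≥ 2`,
whose class passes the `K`-certificate. At `n = 3` the nodal theta geometry locates the cycle but adds
no constraint and no help: the content of the line is the cycle. [cite: Thomas2005Nodes, Thm. 1 and §4 Thms. 5–6]
[cite: vanGeemen1994HodgeAV, proof of Thm. 6.12] -/
theorem weilSixfolds_iff_nodalThetaCarriers₀
    (hK : Kleiman1969_algebraicClasses_le_span_smoothThreefolds)
    (hT : Thomas2005_smoothThreefold_in_nodalMember) :
    Summit.HodgeConjecture.HodgeConjecture.Theses.NodalThetaWeil.WeilSixfolds ↔ NodalThetaCarriers₀ :=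
  ⟨fun hW ↦ nodalThetaCarriers₀_of_threefoldWeilCarriers hK hT (threefoldWeilCarriers_of_weilSixfolds hW),
    fun hN ↦ weilSixfolds_of_threefoldWeilCarriers (threefoldWeilCarriers_of_nodalThetaCarriers₀ hN)⟩

/-- **The crux `NodeDualClassesAlgebraic` (stmt-HodgeConjecture-7745) BY NAME from `NodalThetaCarriers₀`**
(unconditionally: forget the theta clauses and apply part 3). [cite: Thomas2005Nodes, Thm. 1] -/
theorem nodeDualClassesAlgebraic_of_nodalThetaCarriers₀ (hN : NodalThetaCarriers₀) :
    Summit.HodgeConjecture.HodgeConjecture.Theses.NodalThetaWeil.NodeDualClassesAlgebraic :=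
  nodeDualClassesAlgebraic_of_threefoldWeilCarriers (threefoldWeilCarriers_of_nodalThetaCarriers₀ hN)

/-- **The sibling crux `NodalThetaSupport` (stmt-HodgeConjecture-7744) BY NAME from `NodalThetaCarriers₀`**
(unconditionally). [cite: Thomas2005Nodes, Thm. 1] -/
theorem nodalThetaSupport_of_nodalThetaCarriers₀ (hN : NodalThetaCarriers₀) :
    Summit.HodgeConjecture.HodgeConjecture.Theses.NodalThetaWeil.NodalThetaSupport :=
  nodalThetaSupport_of_threefoldWeilCarriers (threefoldWeilCarriers_of_nodalThetaCarriers₀ hN)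

/-- `IsNodalThetaMember A Θ k ι` (display only; same text as in parts 1–3 and the 7744 files). -/
local notation3 "IsNodalThetaMember " A:max Θ:max k:max ι:max =>
  (∃ m : ℕ, 1 ≤ m ∧ IsNodalDivisor 5 m ι ∧
    ∃ hI : IsEffectiveCartier (ι).left.ker,
      (CartierDivisor.ofIsEffectiveCartier (ι).left.ker hI).LinEquiv (k • Θ))

/-- **The nodal-boundary carrier statement of parts 1–3 (with "`≥ 1` node" and "through a node")
implies `NodalThetaCarriers₀`** by forgetting those two clauses. [cite: Thomas2005Nodes, Thm. 1] -/
theorem nodalThetaCarriers₀_of_nodalThetaCarriers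
    (hB : ∀ (d : ℕ), 0 < d → ∀ (A : AbelianVariety ℂ) (φ : A ⟶ A), A.dim = 2 * 3 →
      ∀ hsp : IsSmoothProjective (2 * 3) A.X, φ ≫ φ = -(d • 𝟙 A) →
      Module.finrank ℂ ↥(Module.End.eigenspace (complexBetti.map φ.hom.hom.hom 1).hom
            (Complex.I * (Real.sqrt d : ℂ)) ⊓ hodgeOneZero hsp) = 3 →
      ∃ (Θ : CartierDivisor A.X.left) (k : ℕ) (D : SchemeOver ℂ) (ι : D ⟶ A.X),
        Θ.IsAmple ∧ 2 ≤ k ∧ IsNodalThetaMember A Θ k ι ∧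
        ∃ (V : SchemeOver ℂ) (hV : IsSmoothProjective 3 V) (h : V ⟶ D),
          (∃ v : V.left, ¬ IsRegularLocalRing (D.left.presheaf.stalk (h.left.base v))) ∧
          complexGysin complexOrientationFamily hV hsp (h ≫ ι)
            (rfl : 0 + 2 * (2 * 3) = 2 * 3 + 2 * 3)
            (singularCohomology.one ℂ (ComplexPoints V)) ∉ nonWeil A φ d) :
    NodalThetaCarriers₀ := by
  intro d hd A φ hdim hsp hφ hbal
  obtain ⟨Θ, k, D, ι, hΘ, hk, ⟨m, -, hnod, hI, hlin⟩, V, hV, h, -, hvis⟩ := hB d hd A φ hdim hsp hφ hbal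
  exact ⟨Θ, k, D, ι, hΘ, hk, ⟨m, hnod⟩, ⟨hI, hlin⟩, V, hV, h, hvis⟩

end Free

end Summit.HodgeConjecture.HodgeConjecture.Theorems.NodeDualClassesAlgebraic

end
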